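import Summits.ABC.IUTFork.Cor312RamifiedEIsometric
import Summits.ABC.IUTFork.Cor312PinnedRegionsThreePins
import Summits.ABC.IUTFork.Cor312PilotKummerCompat
import Summits.ABC.IUTFork.Thm311MultiradProofs
import HarnessLib

/-!
# IUT REPAIR BRANCH (rung LADDER-ABC:A2.RP) — the ramified bed under ISOMETRIC readings of Ism, general index `e`: the Corollary's THREE PINS
# ARE SATISFIABLE (valuation-box reading), and for every pinned reading the residual, the typed Corollary and the licence all FAIL —
# an honest PINNED countermodel family at every ramification index `e` and every depth `m ≥ 1`

Record file (D-0012; MODEL DATA `ramDataWithH`/`ramSituationWithH`/`ramColumnWith`/`ramLatticeWithH`/`ramSettingWithH` — gen 4's reading-generic bed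
RAM_{e;G₁,G₂}(p, m) of `Cor312RamifiedEIsmBarrier` with HONEST data (b) `Ψ = {(π^{m·j²})_j}` and the honest column, so that [IUTchIII] Thm. 3.11 (ii) (b)
`KummerB` holds by `rfl` — and the region reading `valBox`/`valRegion`; then proof-only cells; no `Prop` fact; the adjudication-closure files
`Cor312PinnedRegions(ThreePins)` / `Cor312PilotKummerCompat` are IMPORTED, not edited — DEFS-FREEZE) of the abc-iut cell, seat abc-iut-rp-m1 (gen 5;
class (ii) = Mochizuki's replies). TAKES NO SIDE on [IUTchIII] Cor. 3.12 or on any author; typed ≠ proved. Sequel to `Cor312RamifiedEIsometric` (for every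
reading `1 ∈ G₁, G₂ ⊆ isoKE p e` = the valuation-isometries of `K = ℚ_p(p^{1/e})`: every element of ⟨(Ind1)∪(Ind2)⟩ maps every polydisc onto itself;
`ⁿ˒°𝒰 =` Θ-box; typed Corollary and licence FAIL for `m ≥ 1`) and companion of `Repair/CandMochizuki7RamEPins` (under the Dupuy–Hilado reading
`GL(I)` the Θ-pin is UNSATISFIABLE for every `ρ`).

THE VALUATION-BOX READING `valRegion`: `ρ Ψ j v_ℚ :=` the union over the tuples `t ∈ Ψ` of `valBox (t_j)` := the intersection of all polydiscs
containing the `j`-component (`= box(v_π(t_j))`: «the region generated by a Kummer class is its valuation ball» — the reading every honest bed of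
record uses); the constant `box 0` at the unread zero label. KERNEL CELLS (EVERY isometric reading, every prime `p`, every `e ≥ 1`, every `m`):
* **`pinnedRegions3_valRegion` — the three pins `PinnedRegions3` ((hρ)+(pΘ), (pq′), link) HOLD** for `ρ = valRegion`, `qK =` the honest q-datum
  `{(π^m)_j}`: (hρ) because box-preserving indeterminacies commute with `valBox` (`image_valBox`), (pΘ)/(pq′) because `valBox(π^k) = box k`, the link
  pin by `Equiv.refl ℤ` (both pilots are the exponent `1`); with Thm. 3.11 (ii) (b) (`kummerB_ramWithH`, `rfl`) and the bridge hypotheses;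
* **`not_pilotKummerIndRelated_of_pinned_isometric` — for EVERY region reading `ρ` satisfying the two region pins, the director's OBJECT sentence
  `PilotKummerIndRelated` FAILS (`m ≥ 1`)**: the pins force `ρ(qK)₂ = box m` and `ρ(Φ·Θ-datum)₂ = Φ(box 4m) = box 4m`; `not_pilotKummerCompat_isometric`
  — the datum-level residual fails too (valuation classes are rigid, `image_piEltE_eq_piEltE_imp`);
* `not_statementWithH_of_isometric`, `not_licenceWithH_of_isometric` (from the prequel) ⇒ **`not_gapH3_valRegion`, `not_gapA3_valRegion`: the pinned
  schemata are FALSE, non-vacuously**; packaged as **`iso_pinned_countermodel`**.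
READING (neutral; with `CandMochizuki7RamEPins`): on the ramified toy the Corollary's own pins are satisfiable EXACTLY on the side of the Ism split where
nothing is gained — every valuation-isometric (print-like, [IUTchII] Ex. 1.8 (iv)) reading, at every index and depth, is a three-pinned countermodel
to `GapH3`/`GapA3`, extending abc-iut-w5-d230's unramified `pinned_countermodel` to ramified places —, while the DH-sized reading that opens gen 4's
Statement/residual windows cannot carry the Θ-pin at all. A toy (`l⋇ = 2`, one place); no repair is claimed; nothing here bears on [IUTchIII] Cor. 3.12.
[claim: Mochizuki2012, status: disputed] [cite: ScholzeStix2018, §2.2 pp. 9–10] [cite: DupuyHilado2025, §4.9]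
-/

noncomputable section

open Set

namespace Summit.ABC.IUTFork.Repair.CandMochizuki7RamE

open Thm311 Cor312 Cor312.Checks Cor312.IdentifiedNonVacuity Cor312Vol Cor312Vol.NaiveWitness Cor312Vol.PinnedWitness
  Cor312Vol.RamifiedEWitness Literature.IUT.LogThetaLattice
open Cor312Vol.RamifiedWitness (PLe IsPInt ple_zero isPInt_one fib eq_fib ple_ppow_iff)

variable (p e : ℕ) (G₁ G₂ : Set ((Fin e → ℚ) ≃ₗ[ℚ] (Fin e → ℚ)))
  (h₁ : LinearEquiv.refl ℚ (Fin e → ℚ) ∈ G₁) (h₂ : LinearEquiv.refl ℚ (Fin e → ℚ) ∈ G₂) [NeZero e] [hp : Fact p.Prime] (m : ℕ)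

/-! ## 1. The reading-generic bed with honest data (b) and honest column -/

/-- The data (a)(b)(c) of every vertical line of RAM_{e;G₁,G₂}(p, m), HONEST (b): `Ψ = {(π^{m·j²})_j}` at the bad place. [claim: Mochizuki2012, status: disputed] -/
def ramDataWithH : MRData (ramShellsWith p e G₁ G₂ h₁ h₂) where
  shellPk := fun j vQ => {x | Integral p e j vQ x}
  shellSub := fun j v => {x | Integral p e j (toyIndex.over v) x}
  Adm := fun j vQ A => (rFrame p e j vQ).IsBounded A ∧ (rFrame p e j vQ).HasHull A
  logvol := fun j vQ A => rVol p e j vQ ((rFrame p e j vQ).hull A)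
  Ψ := fun v _ => {thetaTupleE p e m v}
  act := fun _ _ _ => 0
  Mmod := fun _ => ∅

/-- The situation of the reading with honest (b). [claim: Mochizuki2012, status: disputed] -/
def ramSituationWithH : Situation toyIndex where
  L := ramShellsWith p e G₁ G₂ h₁ h₂
  D := fun _ => ramDataWithH p e G₁ G₂ h₁ h₂ m
  G := fun _ j => ramDegreesWith p e G₁ G₂ h₁ h₂ j

/-- The honest COLUMN of the reading (verbatim `ramColumnE`: Kummer image of the Θ-pilot splitting monoid at every `(n, m′)` = `{(π^{m·j²})_j}`, unit
images = the packet lattice, pilot objects = exponents). [claim: Mochizuki2012, status: disputed] -/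
def ramColumnWith : Column (ramShellsWith p e G₁ G₂ h₁ h₂) where
  frobAdm := fun _ j vQ A => (rFrame p e j vQ).IsBounded A ∧ (rFrame p e j vQ).HasHull A
  frobLogvol := fun _ j vQ A => rVol p e j vQ ((rFrame p e j vQ).hull A)
  frobΨ := fun _ v _ => {thetaTupleE p e m v}
  frobMmod := fun _ _ => ∅
  unitImage := fun _ _ j vQ => {x | Integral p e j vQ x}
  ballImage := fun _ _ _ => ∅
  ObjLGP := ℤ
  frobObjLGP := fun _ => ℤ
  kumLGP := fun _ => Equiv.refl ℤ
  ObjLgp := ℤ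
  frobObjLgp := fun _ => ℤ
  kumLgp := fun _ => Equiv.refl ℤ
  thetaPilot := fun _ => 1

/-- **The lattice situation RAM_{e;G₁,G₂}^H(p, m)** of the reading: honest (b), honest column. [claim: Mochizuki2012, status: disputed] -/
def ramLatticeWithH : LatticeSituation toyIndex where
  toSituation := ramSituationWithH p e G₁ G₂ h₁ h₂ m
  col := fun _ => ramColumnWith p e G₁ G₂ h₁ h₂ m

/-- **The Cor. 3.12 setting over RAM_{e;G₁,G₂}^H(p, m)**: verbatim the glue of `ramSettingWith` / `ramSettingE` (column `0`, frame the polydiscs, Θ-box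
`box (m·k·j²)`, q-box `box (m·k)`, honest object side `pinSig`). [claim: Mochizuki2012, status: disputed] -/
def ramSettingWithH : Cor312.Setting (ramLatticeWithH p e G₁ G₂ h₁ h₂ m).toSituation where
  n := 0
  HT := ℤ × ℤ
  LogLink := fun _ _ => Unit
  IsFull := fun _ => True
  lattice :=
    { theater := fun n m => (n, m)
      distinct := fun p q h => by simpa using h
      logLink := fun _ _ => ()
      logLink_full := fun _ _ => trivial }
  Frd := Unit
  IsoF := fun _ _ => Unit
  Ob := fun _ => ℤ
  realify := id
  Strip := Unit
  IsoS := fun _ _ => Unit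
  M := fun _ _ => ExpMonoid
  sig := pinSig
  split := { Msplit := fun _ _ => ⊤, exists_gen := fun _ _ => ⟨⟨gen, trivial⟩, top_gen_isGenerator⟩ }
  ObΔ := ℤ
  N := fun _ _ => ExpMonoid
  qData :=
    { q := fun _ _ => gen
      q_gen := fun _ _ => gen_isGenerator
      objOf := fun x => (expOf (x () (Set.mem_univ ())) : ℤ) }
  frame := fun j vQ => rFrame p e j vQ
  hul_adm := fun j vQ _ hH => by obtain ⟨k, rfl⟩ := hH; exact rFrame_bounded_hasHull j vQ k
  thetaRegionOf := fun _ k j vQ => box p e j vQ ((m : ℤ) * k * jsq j)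
  qRegionOf := fun k j vQ => box p e j vQ (if j = 0 then 0 else (m : ℤ) * k)
  qRegion_mem := fun j vQ => ⟨_, rfl⟩
  qSupport_finite := fun _ => Set.toFinite _

/-- [IUTchIII] Thm. 3.11 (ii) (b) `KummerB` HOLDS on the bed (both sides are the honest tuple). [claim: Mochizuki2012, status: disputed] -/
theorem kummerB_ramWithH :
    ((ramLatticeWithH p e G₁ G₂ h₁ h₂ m).col (ramSettingWithH p e G₁ G₂ h₁ h₂ m).n).KummerB
      ((ramLatticeWithH p e G₁ G₂ h₁ h₂ m).D (ramSettingWithH p e G₁ G₂ h₁ h₂ m).n) :=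
  fun _ _ _ => rfl

/-- The Θ-pilot object is the exponent `1`. [folklore] -/
theorem ramSettingWithH_thetaPilot : (ramSettingWithH p e G₁ G₂ h₁ h₂ m).thetaPilot = (1 : ℤ) :=
  congrArg (Nat.cast : ℕ → ℤ)
    (expOf_eq_one_of_isGenerator_top (Classical.choose_spec ((ramSettingWithH p e G₁ G₂ h₁ h₂ m).split.exists_gen () (Set.mem_univ ()))))

/-- The `(n,m′)`-Kummer image of the Θ-pilot at label `j` is `box (m·j²)` (`box 0` at the zero label). [folklore] -/
theorem ramSettingWithH_thetaRegion (m' : ℤ) (j : toyIndex.Label) (vQ : toyIndex.VQ) :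
    (ramSettingWithH p e G₁ G₂ h₁ h₂ m).thetaRegion m' j vQ = box p e j vQ ((m : ℤ) * jsq j) := by
  unfold Setting.thetaRegion
  rw [ramSettingWithH_thetaPilot]
  show box p e j vQ ((m : ℤ) * 1 * jsq j) = _
  rw [mul_one]

/-- The image of the q-pilot at label `j` is `box m` (`box 0` at the zero label). [folklore] -/
theorem ramSettingWithH_qRegion (j : toyIndex.Label) (vQ : toyIndex.VQ) :
    (ramSettingWithH p e G₁ G₂ h₁ h₂ m).qRegion j vQ = box p e j vQ (if j = 0 then 0 else (m : ℤ)) := by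
  show box p e j vQ (if j = 0 then 0 else (m : ℤ) * 1) = _
  rw [mul_one]

/-! ## 2. The valuation-box reading and its equivariance under box-preserving indeterminacies -/

/-- **`valBox x`** = the intersection of all polydiscs containing `x` (`= box(v_π(x))` for a monomial): the region a Kummer class generates. [folklore] -/
def valBox (j : toyIndex.Label) (vQ : toyIndex.VQ) (x : (ramShellsE p e).Packet j vQ) : Set ((ramShellsE p e).Packet j vQ) :=
  {y | ∀ k : ℤ, x ∈ box p e j vQ k → y ∈ box p e j vQ k}

/-- **The VALUATION-BOX REGION READING `valRegion`**: at a nonzero label, the union over the tuples of the datum of the valuation boxes of their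
`j`-components; the constant `box 0` at the zero label. [claim: Mochizuki2012, status: disputed] -/
def valRegion (Ψ : ∀ v : toyIndex.V, v ∈ toyIndex.Vbad → Set ((ramShellsE p e).StarPacket v)) (j : toyIndex.Label) (vQ : toyIndex.VQ) :
    Set ((ramShellsE p e).Packet j vQ) :=
  if hj : j = 0 then box p e j vQ 0 else ⋃ t ∈ Ψ vQ trivial, valBox p e j vQ (t ⟨j, hj⟩)

/-- `valBox(π^k) = box k`. [folklore] -/
theorem valBox_piEltE (j : toyIndex.Label) (vQ : toyIndex.VQ) (k : ℤ) : valBox p e j vQ (piEltE p e j vQ k) = box p e j vQ k := by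
  ext y
  constructor
  · intro hy
    exact hy k ((piEltE_mem_box_iff p e j vQ k k).2 le_rfl)
  · intro hy k' hk'
    rw [piEltE_mem_box_iff] at hk'
    exact box_mono j vQ hk' hy

omit [NeZero e] hp in
variable {p e} in
/-- **A box-preserving indeterminacy commutes with `valBox`**: `Φ(valBox x) = valBox(Φ x)` (`= valBox x`). [folklore] -/
theorem image_valBox {Φ : (ramShellsE p e).PacketAut} (hP : PreservesBoxesE Φ) (j : toyIndex.Label) (vQ : toyIndex.VQ)
    (x : (ramShellsE p e).Packet j vQ) : Φ j vQ '' valBox p e j vQ x = valBox p e j vQ (Φ j vQ x) := by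
  ext z
  constructor
  · rintro ⟨y, hy, rfl⟩ k hk
    exact hP.fwd j vQ k y (hy k ((hP.mem_iff j vQ k x).1 hk))
  · intro hz
    refine ⟨(Φ j vQ).symm z, fun k hk => ?_, (Φ j vQ).apply_symm_apply z⟩
    have h := hP.bwd j vQ k z (hz k ((hP.mem_iff j vQ k x).2 hk))
    rwa [Pi.inv_apply, Pi.inv_apply] at h

omit [NeZero e] hp in
variable {p e} in
/-- **`valRegion` TRANSFORMS WITH THE DATA under every box-preserving indeterminacy** ((hρ) of the Θ-pin). [folklore] -/
theorem valRegion_starAut {Φ : (ramShellsE p e).PacketAut} (hP : PreservesBoxesE Φ)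
    (Ψ : ∀ v : toyIndex.V, v ∈ toyIndex.Vbad → Set ((ramShellsE p e).StarPacket v)) (j : toyIndex.Label) (vQ : toyIndex.VQ) :
    valRegion p e (fun v hv => (ramShellsE p e).starAut Φ v '' Ψ v hv) j vQ = Φ j vQ '' valRegion p e Ψ j vQ := by
  unfold valRegion
  split_ifs with hj
  · exact (hP.image_eq j vQ 0).symm
  · rw [Set.biUnion_image, Set.image_iUnion₂]
    refine Set.iUnion₂_congr fun t _ => ?_
    rw [image_valBox hP]
    rfl

/-! ## 3. Isometric readings: the three pins HOLD for the valuation-box reading -/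

section Iso

variable {G₁ G₂} (hG₁ : G₁ ⊆ isoKE p e) (hG₂ : G₂ ⊆ isoKE p e)

include hG₁ hG₂ in
/-- **(hρ)+(pΘ): the Θ-PIN HOLDS** for `valRegion` on RAM_{e;G₁,G₂}^H(p, m), every isometric reading, every `e`, every `m`. [claim: Mochizuki2012, status: disputed] -/
theorem thetaPinned_valRegion : ThetaPinned (ramLatticeWithH p e G₁ G₂ h₁ h₂ m) (ramSettingWithH p e G₁ G₂ h₁ h₂ m) (valRegion p e) := by
  refine ⟨fun Φ hΦ Ψ j vQ => valRegion_starAut (preservesBoxesE_of_mem_closureIso hG₁ hG₂ hΦ) Ψ j vQ, fun m' j vQ => ?_⟩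
  rw [ramSettingWithH_thetaRegion]
  unfold valRegion
  split_ifs with hj
  · subst hj
    have h0 : jsq (0 : toyIndex.Label) = 0 := rfl
    rw [h0, mul_zero]
  · show _ = ⋃ t ∈ ({thetaTupleE p e m vQ} : Set _), valBox p e j vQ (t ⟨j, hj⟩)
    rw [Set.biUnion_singleton]
    exact (valBox_piEltE p e j vQ _).symm

/-- **(pq′): the q-PIN HOLDS** for `valRegion` with the honest q-datum `{(π^m)_j}`. [claim: Mochizuki2012, status: disputed] -/
theorem qPinned_valRegion : QPinned (ramLatticeWithH p e G₁ G₂ h₁ h₂ m) (ramSettingWithH p e G₁ G₂ h₁ h₂ m) (valRegion p e) (qDatumE p e m) := by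
  intro j vQ
  rw [ramSettingWithH_qRegion]
  unfold valRegion
  split_ifs with hj
  · rfl
  · show _ = ⋃ t ∈ ({qTupleE p e m vQ} : Set _), valBox p e j vQ (t ⟨j, hj⟩)
    rw [Set.biUnion_singleton]
    exact (valBox_piEltE p e j vQ _).symm

/-- **The LINK PIN HOLDS** (`Equiv.refl ℤ`: both pilots are the exponent `1`). [claim: Mochizuki2012, status: disputed] -/
theorem linkPinned_ramWithH : LinkPinned (ramLatticeWithH p e G₁ G₂ h₁ h₂ m) (ramSettingWithH p e G₁ G₂ h₁ h₂ m) :=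
  linkPinned_of_equiv _ _ (Equiv.refl _) (by
    change (ramSettingWithH p e G₁ G₂ h₁ h₂ m).thetaPilot = (ramSettingWithH p e G₁ G₂ h₁ h₂ m).qPilot
    rw [ramSettingWithH_thetaPilot]; rfl)

include hG₁ hG₂ in
/-- **`PinnedRegions3` HOLDS for `(valRegion, {(π^m)_j})` under every isometric reading** — the Corollary's three pins are SATISFIABLE on the ramified bed
of every index. [claim: Mochizuki2012, status: disputed] -/
theorem pinnedRegions3_valRegion :
    PinnedRegions3 (ramLatticeWithH p e G₁ G₂ h₁ h₂ m) (ramSettingWithH p e G₁ G₂ h₁ h₂ m) (valRegion p e) (qDatumE p e m) :=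
  ⟨⟨thetaPinned_valRegion p e h₁ h₂ m hG₁ hG₂, qPinned_valRegion p e h₁ h₂ m⟩, linkPinned_ramWithH p e h₁ h₂ m⟩

/-! ## 4. … and the residual, the typed Corollary and the licence FAIL -/

include hG₁ hG₂ in
/-- **THE OBJECT SENTENCE FAILS FOR EVERY PINNED READING**: under an isometric reading, `m ≥ 1`, every region reading `ρ` satisfying the two region pins
with the honest q-datum violates `PilotKummerIndRelated` — the pins force `ρ(qK)₂ = box m` and `ρ(Φ·{Θ-tuple})₂ = Φ(box 4m) = box 4m`.
[claim: Mochizuki2012, status: disputed] -/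
theorem not_pilotKummerIndRelated_of_pinned_isometric (hm : 1 ≤ m)
    (ρ : (∀ v : toyIndex.V, v ∈ toyIndex.Vbad → Set ((ramShellsE p e).StarPacket v)) →
      ∀ (j : toyIndex.Label) (vQ : toyIndex.VQ), Set ((ramShellsE p e).Packet j vQ))
    (hpin : PinnedRegions (ramLatticeWithH p e G₁ G₂ h₁ h₂ m) (ramSettingWithH p e G₁ G₂ h₁ h₂ m) ρ (qDatumE p e m)) :
    ¬ PilotKummerIndRelated (ramLatticeWithH p e G₁ G₂ h₁ h₂ m) (ramSettingWithH p e G₁ G₂ h₁ h₂ m) ρ (qDatumE p e m) := fun H => by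
  obtain ⟨D', hD', hEq⟩ := H 2 ()
  obtain ⟨Φ, hΦ, rfl⟩ := (MRData.mem_RLGP_iff _ D').1 hD'
  have hj : jsq (2 : toyIndex.Label) = 4 := rfl
  -- the q-side: `ρ(qK)₂ = box m`
  have hq : ρ (qDatumE p e m) 2 () = box p e 2 () m := by
    rw [← hpin.2 2 (), ramSettingWithH_qRegion, if_neg (by decide)]
  -- the Θ-side: `ρ(Φ·{Θ}) = Φ(ρ{Θ}) = Φ(thetaRegion) = Φ(box 4m) = box 4m`
  have hΘ : ρ (((ramLatticeWithH p e G₁ G₂ h₁ h₂ m).D (ramSettingWithH p e G₁ G₂ h₁ h₂ m).n).map Φ).Ψ 2 () = box p e 2 () (4 * (m : ℤ)) := by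
    have hρ := hpin.1.1 Φ hΦ (fun v _ => {thetaTupleE p e m v}) 2 ()
    refine (show ρ (((ramLatticeWithH p e G₁ G₂ h₁ h₂ m).D (ramSettingWithH p e G₁ G₂ h₁ h₂ m).n).map Φ).Ψ 2 () =
      Φ 2 () '' ρ (fun v _ => {thetaTupleE p e m v}) 2 () from hρ).trans ?_
    have hreg := hpin.1.2 0 2 ()
    rw [ramSettingWithH_thetaRegion, hj] at hreg
    have hreg' : ρ (fun v _ => {thetaTupleE p e m v}) 2 () = box p e 2 () ((m : ℤ) * 4) := hreg.symm
    have himg : Φ 2 () '' box p e 2 () ((m : ℤ) * 4) = box p e 2 () ((m : ℤ) * 4) :=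
      (preservesBoxesE_of_mem_closureIso hG₁ hG₂ hΦ).image_eq 2 () _
    rw [hreg', himg, mul_comm]
  rw [hq, hΘ] at hEq
  have h := box_injective (p := p) (e := e) 2 () hEq
  have hm' : (1 : ℤ) ≤ m := by exact_mod_cast hm
  omega

include hG₁ hG₂ in
/-- **The datum-level residual `PilotKummerCompat` FAILS** under every isometric reading (`m ≥ 1`): no indeterminacy carries `π^{4m}` to `π^m`.
[claim: Mochizuki2012, status: disputed] -/
theorem not_pilotKummerCompat_isometric (hm : 1 ≤ m) :
    ¬ PilotKummerCompat (ramLatticeWithH p e G₁ G₂ h₁ h₂ m) (ramSettingWithH p e G₁ G₂ h₁ h₂ m) (qDatumE p e m) := by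
  rintro ⟨Φ, hΦ, m', hm'⟩
  have h2 := hm' () trivial
  change ({qTupleE p e m ()} : Set _) = (ramShellsE p e).starAut Φ () '' {thetaTupleE p e m ()} at h2
  rw [Set.image_singleton, Set.singleton_eq_singleton_iff] at h2
  have h22 : (2 : toyIndex.Label) ≠ 0 := by decide
  have h3 := congrFun h2 ⟨2, h22⟩
  change piEltE p e 2 () m = Φ 2 () (piEltE p e 2 () ((m : ℤ) * jsq 2)) at h3
  have hj : jsq (2 : toyIndex.Label) = 4 := rfl
  rw [hj] at h3
  have h4 := image_piEltE_eq_piEltE_imp hG₁ hG₂ hΦ 2 () h3.symm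
  have hm1 : (1 : ℤ) ≤ m := by exact_mod_cast hm
  omega

include hG₁ hG₂ in
/-- The typed Corollary FAILS on RAM_{e;G₁,G₂}^H(p, m) under every isometric reading (`m ≥ 1`; the glue does not read (b): prequel). [claim: Mochizuki2012, status: disputed] -/
theorem not_statementWithH_of_isometric (hm : 1 ≤ m) : ¬ (ramSettingWithH p e G₁ G₂ h₁ h₂ m).Statement :=
  not_statementWith_of_isometricE p e h₁ h₂ m hG₁ hG₂ hm

include hG₁ hG₂ in
/-- The licence (xi-f) FAILS under every isometric reading (`m ≥ 1`). [claim: Mochizuki2012, status: disputed] -/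
theorem not_licenceWithH_of_isometric (hm : 1 ≤ m) : ¬ Thm311ToCor312.Licence (ramSettingWithH p e G₁ G₂ h₁ h₂ m) :=
  not_licenceWith_of_isometricE p e h₁ h₂ m hG₁ hG₂ hm

include hG₁ hG₂ in
/-- **`GapH3` is FALSE, NON-VACUOUSLY** (pins hold, licence fails). [claim: Mochizuki2012, status: disputed] -/
theorem not_gapH3_valRegion (hm : 1 ≤ m) :
    ¬ GapH3 (ramLatticeWithH p e G₁ G₂ h₁ h₂ m) (ramSettingWithH p e G₁ G₂ h₁ h₂ m) (valRegion p e) (qDatumE p e m) := fun h =>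
  not_licenceWithH_of_isometric p e h₁ h₂ m hG₁ hG₂ hm (h (pinnedRegions3_valRegion p e h₁ h₂ m hG₁ hG₂))

include hG₁ hG₂ in
/-- **`GapA3` is FALSE, NON-VACUOUSLY** (pins hold, residual fails; abc-iut-w5-d230's `gapA3_iff`). [claim: Mochizuki2012, status: disputed] -/
theorem not_gapA3_valRegion (hm : 1 ≤ m) :
    ¬ GapA3 (ramLatticeWithH p e G₁ G₂ h₁ h₂ m) (ramSettingWithH p e G₁ G₂ h₁ h₂ m) (valRegion p e) (qDatumE p e m) := fun h =>
  not_pilotKummerIndRelated_of_pinned_isometric p e h₁ h₂ m hG₁ hG₂ hm (valRegion p e) (pinnedRegions3_valRegion p e h₁ h₂ m hG₁ hG₂).1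
    ((gapA3_iff _ _ _ _ (kummerB_ramWithH p e G₁ G₂ h₁ h₂ m)).1 h (pinnedRegions3_valRegion p e h₁ h₂ m hG₁ hG₂))

/-- The bridge hypotheses and `|log(q)| > 0` (those of gen 4's reading-generic setting, field by field). [folklore] -/
theorem ramSettingWithH_bridgeHyps_absLogQPos (hG₁' : G₁ ⊆ latticeAuts p e) (hG₂' : G₂ ⊆ latticeAuts p e) (hm : 1 ≤ m) :
    BridgeHyps (ramSettingWithH p e G₁ G₂ h₁ h₂ m) ∧ (ramSettingWithH p e G₁ G₂ h₁ h₂ m).AbsLogQPos :=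
  have h := ramSettingWith_bridgeHyps p e h₁ h₂ m hG₁' hG₂'
  ⟨{ mono := h.mono, image_adm := h.image_adm, image_fin := h.image_fin, hul_nonempty := h.hul_nonempty,
      theta_nonempty := h.theta_nonempty, finite := h.finite }, ramSettingWith_absLogQPos p e h₁ h₂ m hm⟩

include hG₁ hG₂ in
/-- **THE PINNED COUNTERMODEL AT EVERY RAMIFICATION INDEX AND DEPTH, PACKAGED** (every isometric reading `1 ∈ G₁, G₂ ⊆ isoKE`, every prime `p`, every
`e ≥ 1`, every `m ≥ 1`): Thm. 3.11 (ii) (b), the bridge hypotheses, `|log(q)| > 0` and the THREE PINS hold for the valuation-box reading with the honest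
q-datum — and the OBJECT sentence `PilotKummerIndRelated`, its inline form `PilotKummerCompat`, the typed Corollary 3.12, the licence (xi-f) and the
pinned schemata `GapH3`, `GapA3` all FAIL. [claim: Mochizuki2012, status: disputed] -/
theorem iso_pinned_countermodel (hm : 1 ≤ m) :
    ((ramLatticeWithH p e G₁ G₂ h₁ h₂ m).col (ramSettingWithH p e G₁ G₂ h₁ h₂ m).n).KummerB
        ((ramLatticeWithH p e G₁ G₂ h₁ h₂ m).D (ramSettingWithH p e G₁ G₂ h₁ h₂ m).n) ∧
      BridgeHyps (ramSettingWithH p e G₁ G₂ h₁ h₂ m) ∧ (ramSettingWithH p e G₁ G₂ h₁ h₂ m).AbsLogQPos ∧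
      PinnedRegions3 (ramLatticeWithH p e G₁ G₂ h₁ h₂ m) (ramSettingWithH p e G₁ G₂ h₁ h₂ m) (valRegion p e) (qDatumE p e m) ∧
      ¬ PilotKummerIndRelated (ramLatticeWithH p e G₁ G₂ h₁ h₂ m) (ramSettingWithH p e G₁ G₂ h₁ h₂ m) (valRegion p e) (qDatumE p e m) ∧
      ¬ PilotKummerCompat (ramLatticeWithH p e G₁ G₂ h₁ h₂ m) (ramSettingWithH p e G₁ G₂ h₁ h₂ m) (qDatumE p e m) ∧
      ¬ (ramSettingWithH p e G₁ G₂ h₁ h₂ m).Statement ∧ ¬ Thm311ToCor312.Licence (ramSettingWithH p e G₁ G₂ h₁ h₂ m) ∧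
      ¬ GapH3 (ramLatticeWithH p e G₁ G₂ h₁ h₂ m) (ramSettingWithH p e G₁ G₂ h₁ h₂ m) (valRegion p e) (qDatumE p e m) ∧
      ¬ GapA3 (ramLatticeWithH p e G₁ G₂ h₁ h₂ m) (ramSettingWithH p e G₁ G₂ h₁ h₂ m) (valRegion p e) (qDatumE p e m) :=
  have hB := ramSettingWithH_bridgeHyps_absLogQPos p e h₁ h₂ m (hG₁.trans (isoKE_subset_latticeAuts p e)) (hG₂.trans (isoKE_subset_latticeAuts p e)) hm
  ⟨kummerB_ramWithH p e G₁ G₂ h₁ h₂ m, hB.1, hB.2, pinnedRegions3_valRegion p e h₁ h₂ m hG₁ hG₂,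
    not_pilotKummerIndRelated_of_pinned_isometric p e h₁ h₂ m hG₁ hG₂ hm _ (pinnedRegions3_valRegion p e h₁ h₂ m hG₁ hG₂).1,
    not_pilotKummerCompat_isometric p e h₁ h₂ m hG₁ hG₂ hm, not_statementWithH_of_isometric p e h₁ h₂ m hG₁ hG₂ hm,
    not_licenceWithH_of_isometric p e h₁ h₂ m hG₁ hG₂ hm, not_gapH3_valRegion p e h₁ h₂ m hG₁ hG₂ hm, not_gapA3_valRegion p e h₁ h₂ m hG₁ hG₂ hm⟩

/-- **The maximal isometric reading itself** (`Gᵢ = isoKE p e`): the pinned countermodel at every `(e, m ≥ 1)`. [claim: Mochizuki2012, status: disputed] -/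
theorem isoKE_pinned_countermodel (hm : 1 ≤ m) :
    PinnedRegions3 (ramLatticeWithH p e (isoKE p e) (isoKE p e) (refl_mem_isoKE p e) (refl_mem_isoKE p e) m)
        (ramSettingWithH p e (isoKE p e) (isoKE p e) (refl_mem_isoKE p e) (refl_mem_isoKE p e) m) (valRegion p e) (qDatumE p e m) ∧
      ¬ GapH3 (ramLatticeWithH p e (isoKE p e) (isoKE p e) (refl_mem_isoKE p e) (refl_mem_isoKE p e) m)
        (ramSettingWithH p e (isoKE p e) (isoKE p e) (refl_mem_isoKE p e) (refl_mem_isoKE p e) m) (valRegion p e) (qDatumE p e m) :=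
  ⟨pinnedRegions3_valRegion p e _ _ m subset_rfl subset_rfl, not_gapH3_valRegion p e _ _ m subset_rfl subset_rfl hm⟩

end Iso

end Summit.ABC.IUTFork.Repair.CandMochizuki7RamE

end
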